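import Literature.NumberTheory.Automorphic.PadicPlaceCoefficientRingFinite
import Mathlib.RingTheory.IntegralClosure.IsIntegral.Basic
import Mathlib.Algebra.Order.Archimedean.Basic
import HarnessLib

/-!
# Stage coefficient rings `𝒪_E[S] ⊂ ℚ̄_p` for finite sets `S` of `p`-adic integers

Topic `NumberTheory/Automorphic`; namespace `Literature.NumberTheory.Automorphic.ParallelWeight`.
Definitions with bodies and theorems; no named fact, no `sorry`.

In the proof of [Scholze2015, Thm. V.4.1] a class `ξ ∈ H^q(X_U, Ṽ)`, `Ṽ` with `ℚ̄_p`-coefficients,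
is compared with the integral structure `M̃ ⊗ 𝒪_E`; since `ℚ̄_p = ⋃_{E'} E'` and `V = ⋃ p^{-t} M_{E'}`,
one needs the coefficient rings of all the finite stages.  Here, for a finite set `S ⊂ ℚ̄_p` of
elements of norm `≤ 1`:

* `stageRing K p S = ℤ_p[𝒪_E ∪ S] ⊂ ℚ̄_p` (`𝒪_E = coeffRing K p`), containing `𝒪_E`
  (`coeffRing_le_stageRing`) and `S`, monotone in `S`, contained in the valuation ring
  (`valued_le_one_of_mem_stageRing`), containing all the `p`-adic embeddings of the `p`-adic
  integers of `K` (`padicPlaceHom_mem_stageRing`);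
* **`exists_finset_span_eq_stageRing`** — `stageRing K p S` is a finitely generated `ℤ_p`-module
  (spanned by a finite set), by `fg_adjoin_of_finite` (adjoining finitely many integral elements to
  the module-finite `𝒪_E`);
* `exists_pow_mul_norm_le_one(_finset)` — every (finite set of) scalar(s) of scalars of `ℚ̄_p` becomes integral after
  multiplication by a power of `p` (so `V = ⋃_{S,t} p^{-t} M_{𝒪_E[S]}`).

## References

* P. Scholze, *On torsion in the cohomology of locally symmetric varieties*, Ann. of Math. 182
  (2015), §V.4, proof of Thm. V.4.1. [Scholze2015]
* J. Neukirch, *Algebraic Number Theory* (1999), Ch. II (4.8), (6.8). [NeukirchANT1999]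
-/

noncomputable section

open scoped Classical

namespace Literature.NumberTheory.Automorphic.ParallelWeight

variable (K : Type) [Field K] [NumberField K] (p : ℕ) [Fact p.Prime]

/-! ### The stage rings -/

/-- **The stage ring `ℤ_p[𝒪_E ∪ S]`** generated over `ℤ_p` by the coefficient ring `𝒪_E` and a
finite set `S`. [cite: Scholze2015, §V.4 (proof of Thm. V.4.1)] -/
def stageRing (S : Finset (PadicAlgCl p)) : Subring (PadicAlgCl p) :=
  (Algebra.adjoin ℤ_[p] ((coeffRing K p : Set (PadicAlgCl p)) ∪ (S : Set (PadicAlgCl p)))).toSubring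

/-- Membership in the stage ring is membership in the adjoined subalgebra. [folklore] -/
theorem mem_stageRing_iff (S : Finset (PadicAlgCl p)) (x : PadicAlgCl p) :
    x ∈ stageRing K p S ↔
      x ∈ Algebra.adjoin ℤ_[p] ((coeffRing K p : Set (PadicAlgCl p)) ∪ (S : Set (PadicAlgCl p))) :=
  Iff.rfl

/-- `𝒪_E ≤ 𝒪_E[S]`. [folklore] -/
theorem coeffRing_le_stageRing (S : Finset (PadicAlgCl p)) : coeffRing K p ≤ stageRing K p S :=
  fun _ hx => (mem_stageRing_iff K p S _).2 (Algebra.subset_adjoin (Set.mem_union_left _ hx))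

/-- `S ⊆ 𝒪_E[S]`. [folklore] -/
theorem subset_stageRing (S : Finset (PadicAlgCl p)) : (S : Set (PadicAlgCl p)) ⊆ stageRing K p S :=
  fun _ hx => (mem_stageRing_iff K p S _).2 (Algebra.subset_adjoin (Set.mem_union_right _ hx))

/-- The stage rings are monotone in `S`. [folklore] -/
theorem stageRing_mono {S S' : Finset (PadicAlgCl p)} (h : S ⊆ S') :
    stageRing K p S ≤ stageRing K p S' := fun _ hx =>
  (mem_stageRing_iff K p S' _).2
    (Algebra.adjoin_mono (Set.union_subset_union_right _ (Finset.coe_subset.2 h))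
      ((mem_stageRing_iff K p S _).1 hx))

/-- The `p`-adic embeddings of the `p`-adic integers of `K` lie in every stage ring. [folklore] -/
theorem padicPlaceHom_mem_stageRing (S : Finset (PadicAlgCl p)) (τ : K →+* PadicAlgCl p)
    (y : (padicPlace K p τ).adicCompletion K) (hy : Valued.v y ≤ 1) :
    padicPlaceHom K p τ y ∈ stageRing K p S :=
  coeffRing_le_stageRing K p S (padicPlaceHom_mem_coeffRing K p τ y hy)

/-- `ℤ_p → 𝒪_E[S]`. [folklore] -/
theorem algebraMap_padicInt_mem_stageRing (S : Finset (PadicAlgCl p)) (z : ℤ_[p]) :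
    algebraMap ℤ_[p] (PadicAlgCl p) z ∈ stageRing K p S :=
  coeffRing_le_stageRing K p S (algebraMap_padicInt_mem_coeffRing p K z)

/-! ### Integrality -/

/-- `|x| ≤ 1 ↔ v(x) ≤ 1` in `ℚ̄_p`. [folklore] -/
theorem norm_le_one_iff_valued_le_one (x : PadicAlgCl p) : ‖x‖ ≤ 1 ↔ Valued.v x ≤ 1 := by
  rw [PadicAlgCl.valuation_def, ← NNReal.coe_le_coe, coe_nnnorm, NNReal.coe_one]

/-- The closed unit ball of `ℚ̄_p` as a `ℤ_p`-subalgebra (the valuation ring). [folklore] -/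
def unitBallSubalgebra : Subalgebra ℤ_[p] (PadicAlgCl p) where
  __ := (Valued.v (R := PadicAlgCl p)).valuationSubring.toSubring
  algebraMap_mem' z := by
    change Valued.v (algebraMap ℤ_[p] (PadicAlgCl p) z) ≤ 1
    rw [← norm_le_one_iff_valued_le_one]
    exact norm_algebraMap_padicInt_le_one p z

/-- Membership in the unit-ball subalgebra. [folklore] -/
theorem mem_unitBallSubalgebra_iff (x : PadicAlgCl p) : x ∈ unitBallSubalgebra p ↔ Valued.v x ≤ 1 :=
  Iff.rfl

/-- **Stage rings are integral**: if all elements of `S` have norm `≤ 1`, then `𝒪_E[S]` lies in the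
valuation ring. [folklore] -/
theorem valued_le_one_of_mem_stageRing {S : Finset (PadicAlgCl p)} (hS : ∀ c ∈ S, ‖c‖ ≤ 1)
    {x : PadicAlgCl p} (hx : x ∈ stageRing K p S) : Valued.v x ≤ 1 := by
  have hle : Algebra.adjoin ℤ_[p] ((coeffRing K p : Set (PadicAlgCl p)) ∪ (S : Set (PadicAlgCl p))) ≤
      unitBallSubalgebra p := by
    refine Algebra.adjoin_le ?_
    rintro y (hy | hy)
    · exact valued_le_one_of_mem_coeffRing K p hy
    · exact (norm_le_one_iff_valued_le_one p y).1 (hS y hy)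
  exact (mem_unitBallSubalgebra_iff p x).1 (hle ((mem_stageRing_iff K p S x).1 hx))

/-- Norm form of `valued_le_one_of_mem_stageRing`. [folklore] -/
theorem norm_le_one_of_mem_stageRing {S : Finset (PadicAlgCl p)} (hS : ∀ c ∈ S, ‖c‖ ≤ 1)
    {x : PadicAlgCl p} (hx : x ∈ stageRing K p S) : ‖x‖ ≤ 1 :=
  (norm_le_one_iff_valued_le_one p x).2 (valued_le_one_of_mem_stageRing K p hS hx)

/-- `p` is not a unit of a stage ring (its inverse has norm `> 1`). [folklore] -/
theorem not_isUnit_natCast_prime_stageRing {S : Finset (PadicAlgCl p)} (hS : ∀ c ∈ S, ‖c‖ ≤ 1) :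
    ¬ IsUnit (((p : ℕ) : stageRing K p S)) := by
  rintro ⟨u, hu⟩
  have hinv : ((u⁻¹ : (stageRing K p S)ˣ) : stageRing K p S).1 * (p : PadicAlgCl p) = 1 := by
    have h := congrArg (fun y : stageRing K p S => (y : PadicAlgCl p)) u.inv_mul
    rw [hu] at h
    simpa using h
  have hnorm := norm_le_one_of_mem_stageRing K p hS ((u⁻¹ : (stageRing K p S)ˣ) : stageRing K p S).2
  have hp : ‖(p : PadicAlgCl p)‖ < 1 := by
    rw [show ((p : ℕ) : PadicAlgCl p) = (((p : ℕ) : ℚ_[p]) : PadicAlgCl p) by simp,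
      PadicAlgCl.norm_extends, Padic.norm_p]
    exact inv_lt_one_of_one_lt₀ (by exact_mod_cast (Fact.out : p.Prime).one_lt)
  have h1 : ‖((u⁻¹ : (stageRing K p S)ˣ) : stageRing K p S).1 * (p : PadicAlgCl p)‖ < 1 := by
    rw [norm_mul]
    calc ‖((u⁻¹ : (stageRing K p S)ˣ) : stageRing K p S).1‖ * ‖(p : PadicAlgCl p)‖
        ≤ 1 * ‖(p : PadicAlgCl p)‖ := by gcongr
      _ < 1 := by rw [one_mul]; exact hp
  rw [hinv, norm_one] at h1
  exact lt_irrefl _ h1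

/-! ### Finiteness over `ℤ_p` -/

/-- `𝒪_E` is spanned over `ℤ_p` by a finite set. [cite: NeukirchANT1999, Ch. II (6.8)] -/
theorem exists_finset_span_eq_coeffRing :
    ∃ B : Finset (PadicAlgCl p), (B : Set (PadicAlgCl p)) ⊆ coeffRing K p ∧
      ∀ x ∈ coeffRing K p, x ∈ Submodule.span ℤ_[p] (B : Set (PadicAlgCl p)) := by
  obtain ⟨B₀, hB₀⟩ := (Module.finite_def.1 (moduleFinite_coeffRing p K))
  refine ⟨B₀.image (fun y : coeffRing K p => (y : PadicAlgCl p)), ?_, ?_⟩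
  · intro x hx
    rw [Finset.coe_image] at hx
    obtain ⟨y, -, rfl⟩ := hx
    exact y.2
  · intro x hx
    have hx' : (⟨x, hx⟩ : coeffRing K p) ∈ Submodule.span ℤ_[p] (B₀ : Set (coeffRing K p)) := by
      rw [hB₀]; exact Submodule.mem_top
    let f : coeffRing K p →ₗ[ℤ_[p]] PadicAlgCl p :=
      (IsScalarTower.toAlgHom ℤ_[p] (coeffRing K p) (PadicAlgCl p)).toLinearMap
    have hf : ∀ y : coeffRing K p, f y = (y : PadicAlgCl p) := fun y => rfl
    have himg : f ⟨x, hx⟩ ∈ Submodule.span ℤ_[p] (f '' (B₀ : Set (coeffRing K p))) := by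
      rw [← Submodule.map_span]; exact Submodule.mem_map_of_mem hx'
    rw [Finset.coe_image, show ((fun y : coeffRing K p => (y : PadicAlgCl p)) '' (B₀ : Set (coeffRing K p))) =
      f '' (B₀ : Set (coeffRing K p)) from Set.image_congr fun y _ => (hf y).symm]
    exact himg

/-- **`𝒪_E[S]` is a finitely generated `ℤ_p`-module** (spanned by a finite subset), for `S` a
finite set of elements of norm `≤ 1`. [cite: Scholze2015, §V.4 (proof of Thm. V.4.1)] -/
theorem exists_finset_span_eq_stageRing {S : Finset (PadicAlgCl p)} (hS : ∀ c ∈ S, ‖c‖ ≤ 1) :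
    ∃ T : Finset (PadicAlgCl p), (T : Set (PadicAlgCl p)) ⊆ stageRing K p S ∧
      ∀ x ∈ stageRing K p S, x ∈ Submodule.span ℤ_[p] (T : Set (PadicAlgCl p)) := by
  obtain ⟨B, hB, hBspan⟩ := exists_finset_span_eq_coeffRing K p
  -- `ℤ_p[𝒪_E ∪ S] = ℤ_p[B ∪ S]`
  have hadj : Algebra.adjoin ℤ_[p] ((coeffRing K p : Set (PadicAlgCl p)) ∪ (S : Set (PadicAlgCl p))) =
      Algebra.adjoin ℤ_[p] ((B : Set (PadicAlgCl p)) ∪ (S : Set (PadicAlgCl p))) := by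
    apply le_antisymm
    · refine Algebra.adjoin_le ?_
      rintro y (hy | hy)
      · have h := hBspan y hy
        have hsub : (B : Set (PadicAlgCl p)) ⊆ Subalgebra.toSubmodule
            (Algebra.adjoin ℤ_[p] ((B : Set (PadicAlgCl p)) ∪ (S : Set (PadicAlgCl p)))) :=
          fun b hb => Algebra.subset_adjoin (Set.mem_union_left _ hb)
        exact Submodule.span_le.2 hsub h
      · exact Algebra.subset_adjoin (Set.mem_union_right _ hy)
    · exact Algebra.adjoin_mono (Set.union_subset_union_left _ hB)
  have hfg : (Subalgebra.toSubmodule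
      (Algebra.adjoin ℤ_[p] ((B : Set (PadicAlgCl p)) ∪ (S : Set (PadicAlgCl p))))).FG := by
    refine fg_adjoin_of_finite ((B.finite_toSet).union S.finite_toSet) ?_
    rintro y (hy | hy)
    · exact isIntegral_padicInt_of_norm_le_one p
        ((norm_le_one_iff_valued_le_one p y).2 (valued_le_one_of_mem_coeffRing K p (hB hy)))
    · exact isIntegral_padicInt_of_norm_le_one p (hS y hy)
  obtain ⟨T, hT⟩ := hfg
  refine ⟨T, ?_, ?_⟩
  · intro x hx
    rw [SetLike.mem_coe, mem_stageRing_iff, hadj, ← Subalgebra.mem_toSubmodule, ← hT]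
    exact Submodule.subset_span hx
  · intro x hx
    rw [mem_stageRing_iff, hadj, ← Subalgebra.mem_toSubmodule, ← hT] at hx
    exact hx

/-! ### Scaling into the unit ball -/

/-- Every element of `ℚ̄_p` becomes integral after multiplication by a power of `p`
(`|p| < 1`, see also `GaloisRepresentations.norm_natCast_padicAlgCl_lt_one`). [folklore] -/
theorem exists_pow_mul_norm_le_one (c : PadicAlgCl p) : ∃ t : ℕ, ‖((p : ℕ) : PadicAlgCl p) ^ t * c‖ ≤ 1 := by
  by_cases hc : c = 0
  · exact ⟨0, by simp [hc]⟩
  have hcpos : 0 < ‖c‖⁻¹ := inv_pos.2 (norm_pos_iff.2 hc)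
  have hp : ‖((p : ℕ) : PadicAlgCl p)‖ < 1 := by
    rw [show ((p : ℕ) : PadicAlgCl p) = (((p : ℕ) : ℚ_[p]) : PadicAlgCl p) by simp,
      PadicAlgCl.norm_extends, Padic.norm_p]
    exact inv_lt_one_of_one_lt₀ (by exact_mod_cast (Fact.out : p.Prime).one_lt)
  obtain ⟨t, ht⟩ := exists_pow_lt_of_lt_one hcpos hp
  refine ⟨t, ?_⟩
  rw [norm_mul, norm_pow]
  have h : ‖((p : ℕ) : PadicAlgCl p)‖ ^ t * ‖c‖ < ‖c‖⁻¹ * ‖c‖ :=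
    mul_lt_mul_of_pos_right ht (norm_pos_iff.2 hc)
  rw [inv_mul_cancel₀ (norm_ne_zero_iff.2 hc)] at h
  exact h.le

/-- Powers of `p` only improve integrality. [folklore] -/
theorem norm_pow_mul_le_of_le {c : PadicAlgCl p} {t t' : ℕ} (htt' : t ≤ t')
    (h : ‖((p : ℕ) : PadicAlgCl p) ^ t * c‖ ≤ 1) : ‖((p : ℕ) : PadicAlgCl p) ^ t' * c‖ ≤ 1 := by
  obtain ⟨d, rfl⟩ := Nat.exists_eq_add_of_le htt'
  rw [pow_add, mul_comm (_ ^ t) (_ ^ d), mul_assoc, norm_mul]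
  have hp : ‖((p : ℕ) : PadicAlgCl p)‖ ≤ 1 := by
    rw [show ((p : ℕ) : PadicAlgCl p) = (((p : ℕ) : ℚ_[p]) : PadicAlgCl p) by simp,
      PadicAlgCl.norm_extends]
    exact_mod_cast (Padic.norm_p_lt_one (p := p)).le
  calc ‖((p : ℕ) : PadicAlgCl p) ^ d‖ * ‖((p : ℕ) : PadicAlgCl p) ^ t * c‖ ≤ 1 * 1 := by
        gcongr
        rw [norm_pow]
        exact pow_le_one₀ (norm_nonneg _) hp
    _ = 1 := one_mul 1

/-- **A finite set of scalars becomes integral after multiplication by a common power of `p`.**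
[folklore] -/
theorem exists_pow_mul_norm_le_one_finset (C : Finset (PadicAlgCl p)) :
    ∃ t : ℕ, ∀ c ∈ C, ‖((p : ℕ) : PadicAlgCl p) ^ t * c‖ ≤ 1 := by
  induction C using Finset.induction_on with
  | empty => exact ⟨0, fun c hc => absurd hc (Finset.notMem_empty c)⟩
  | insert a C ha ih =>
    obtain ⟨t₁, ht₁⟩ := ih
    obtain ⟨t₂, ht₂⟩ := exists_pow_mul_norm_le_one p a
    refine ⟨max t₁ t₂, fun c hc => ?_⟩
    rcases Finset.mem_insert.1 hc with rfl | hc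
    · exact norm_pow_mul_le_of_le p (le_max_right _ _) ht₂
    · exact norm_pow_mul_le_of_le p (le_max_left _ _) (ht₁ c hc)

end Literature.NumberTheory.Automorphic.ParallelWeight
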